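import Literature.NumberTheory.LFunctions.WeilThreePrimeSliver
import HarnessLib

/-!
# HANDOFF: the sliver-MASS bound for the spike `k(x) + k(−x)` (rh-explicit, track «HANDOFF», seat prove-2)

HONEST FRAMING. Nothing here bears on RH. This is the elementary estimate (0.1) of the seat's ATTEMPT-1, sharpening the
tree's `norm_weilConv_weilReflect_add_neg_le` (which bounds by the WHOLE norm `‖g‖₂²`): for a test function `g` supported
in `[−b, b]` and any shift `x`, the autocorrelation `k = g ⋆ g̃` satisfies
`‖k(x)‖ ≤ ½(∫_{[x−b, b]} |g|² + ∫_{[−b, b−x]} |g|²)` and hence `‖k(x) + k(−x)‖ ≤ ∫_{[x−b, b]} |g|² + ∫_{[−b, b−x]} |g|²` —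
only the two SLIVERS of length `2b − x` at the edges of the window carry the spike. With `x = log q` on the HANDOFF window
this is the statement that the contribution of the prime `q` is carried by the sliver mass (`contribution ≤ w_q · m_ℓ`).
-/

set_option linter.dupNamespace false

noncomputable section

open Complex Filter Set MeasureTheory Literature.NumberTheory.LFunctions
open scoped Real Topology ComplexConjugate

namespace Summit.RiemannHypothesis.RiemannHypothesis.Theorems.Handoff

variable {g : ℝ → ℂ}

/-- **Sliver-mass bound for one shift**: for `tsupport g ⊆ [−b, b]` and any `x`,
`‖(g ⋆ g̃)(x)‖ ≤ ½ (∫_{[x−b, b]} ‖g‖² + ∫_{[−b, b−x]} ‖g‖²)` (the integrand `g(u) conj g(u−x)` lives on `u ∈ [x−b, b]`,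
`u − x ∈ [−b, b−x]`, and `2|g(u)||g(u−x)| ≤ |g(u)|² + |g(u−x)|²`). [cite: Bombieri2000, §4 Lemma 2 (sharpened to the slivers)] -/
theorem norm_weilConv_weilReflect_le_sliver (hg : IsWeilTest g) {b : ℝ} (hsupp : tsupport g ⊆ Icc (-b) b) (x : ℝ) :
    ‖weilConv g (weilReflect g) x‖ ≤
      ((∫ u in Icc (x - b) b, ‖g u‖ ^ 2) + ∫ u in Icc (-b) (b - x), ‖g u‖ ^ 2) / 2 := by
  have h2 : Integrable fun u : ℝ ↦ ‖g u‖ ^ 2 := hg.integrable_norm_sq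
  set φ : ℝ → ℝ := (Icc (x - b) b).indicator fun u ↦ ‖g u‖ ^ 2 with hφ
  set ψ : ℝ → ℝ := (Icc (-b) (b - x)).indicator fun u ↦ ‖g u‖ ^ 2 with hψ
  have hφi : Integrable φ := h2.indicator measurableSet_Icc
  have hψi : Integrable ψ := h2.indicator measurableSet_Icc
  have hψi' : Integrable fun u : ℝ ↦ ψ (u - x) := hψi.comp_sub_right x
  have hφ0 : ∀ u, 0 ≤ φ u := fun u ↦ Set.indicator_nonneg (fun _ _ ↦ by positivity) u
  have hψ0 : ∀ u, 0 ≤ ψ u := fun u ↦ Set.indicator_nonneg (fun _ _ ↦ by positivity) u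
  have hzero : ∀ u, g u ≠ 0 → u ∈ Icc (-b) b := fun u hu ↦ hsupp (subset_tsupport _ hu)
  -- pointwise: 2 |g(u)| |g(u − x)| ≤ φ(u) + ψ(u − x)
  have hpt : ∀ u, ‖g u * weilReflect g (x - u)‖ ≤ (φ u + ψ (u - x)) / 2 := by
    intro u
    simp only [weilReflect, norm_mul, Complex.norm_conj, neg_sub]
    by_cases hgu : g u = 0
    · rw [hgu, norm_zero, zero_mul]; linarith [hφ0 u, hψ0 (u - x)]
    by_cases hgv : g (u - x) = 0
    · rw [hgv, norm_zero, mul_zero]; linarith [hφ0 u, hψ0 (u - x)]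
    have hu := hzero u hgu
    have hv := hzero (u - x) hgv
    have h1 : u ∈ Icc (x - b) b := ⟨by linarith [hv.1], hu.2⟩
    have h2' : u - x ∈ Icc (-b) (b - x) := ⟨hv.1, by linarith [hu.2]⟩
    rw [hφ, hψ, Set.indicator_of_mem h1, Set.indicator_of_mem h2']
    linarith [two_mul_le_add_sq ‖g u‖ ‖g (u - x)‖]
  rw [weilConv_apply]
  calc ‖∫ u : ℝ, g u * weilReflect g (x - u)‖
      ≤ ∫ u : ℝ, ‖g u * weilReflect g (x - u)‖ := norm_integral_le_integral_norm _
    _ ≤ ∫ u : ℝ, (φ u + ψ (u - x)) / 2 :=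
        integral_mono_of_nonneg (Eventually.of_forall fun _ ↦ norm_nonneg _)
          ((hφi.add hψi').div_const 2) (Eventually.of_forall hpt)
    _ = ((∫ u : ℝ, φ u) + ∫ u : ℝ, ψ u) / 2 := by
        rw [integral_div, integral_add hφi hψi', integral_sub_right_eq_self ψ x]
    _ = ((∫ u in Icc (x - b) b, ‖g u‖ ^ 2) + ∫ u in Icc (-b) (b - x), ‖g u‖ ^ 2) / 2 := by
        rw [hφ, hψ, integral_indicator measurableSet_Icc, integral_indicator measurableSet_Icc]

/-- **Sliver-mass bound for the spike**: `‖k(x) + k(−x)‖ ≤ ∫_{[x−b, b]} ‖g‖² + ∫_{[−b, b−x]} ‖g‖²` (`k(−x) = conj k(x)`).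
On the HANDOFF window (`x = log q`, `b ≤ (log q′)/2`) the two slivers have length `2b − log q ≤ log(q′/q)`: the contribution of
the prime `q` is carried by the sliver mass. [cite: Bombieri2000, §4 Lemma 2 (sharpened to the slivers)] -/
theorem norm_weilConv_weilReflect_add_neg_le_sliver (hg : IsWeilTest g) {b : ℝ} (hsupp : tsupport g ⊆ Icc (-b) b)
    (x : ℝ) :
    ‖weilConv g (weilReflect g) x + weilConv g (weilReflect g) (-x)‖ ≤
      (∫ u in Icc (x - b) b, ‖g u‖ ^ 2) + ∫ u in Icc (-b) (b - x), ‖g u‖ ^ 2 := by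
  have h := norm_weilConv_weilReflect_le_sliver hg hsupp x
  have h' : ‖weilConv g (weilReflect g) (-x)‖ ≤
      ((∫ u in Icc (x - b) b, ‖g u‖ ^ 2) + ∫ u in Icc (-b) (b - x), ‖g u‖ ^ 2) / 2 := by
    rw [← conj_weilConv_weilReflect_neg, Complex.norm_conj] at h; exact h
  calc ‖weilConv g (weilReflect g) x + weilConv g (weilReflect g) (-x)‖
      ≤ ‖weilConv g (weilReflect g) x‖ + ‖weilConv g (weilReflect g) (-x)‖ := norm_add_le _ _
    _ ≤ (∫ u in Icc (x - b) b, ‖g u‖ ^ 2) + ∫ u in Icc (-b) (b - x), ‖g u‖ ^ 2 := by linarith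

/-- Real-part form, in the shape of the seat's `SliverBound` (`ℓ = 2b − x`: `[b − ℓ, b] = [x − b, b]`,
`[−b, −b + ℓ] = [−b, b − x]`). [cite: Bombieri2000, §4 Lemma 2 (sharpened to the slivers)] -/
theorem abs_re_weilConv_weilReflect_add_neg_le_sliver (hg : IsWeilTest g) {b : ℝ} (hsupp : tsupport g ⊆ Icc (-b) b)
    (x : ℝ) :
    |(weilConv g (weilReflect g) x + weilConv g (weilReflect g) (-x)).re| ≤
      (∫ u in Icc (b - (2 * b - x)) b, ‖g u‖ ^ 2) + ∫ u in Icc (-b) (-b + (2 * b - x)), ‖g u‖ ^ 2 := by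
  have e1 : b - (2 * b - x) = x - b := by ring
  have e2 : -b + (2 * b - x) = b - x := by ring
  rw [e1, e2]
  exact (Complex.abs_re_le_norm _).trans (norm_weilConv_weilReflect_add_neg_le_sliver hg hsupp x)

end Summit.RiemannHypothesis.RiemannHypothesis.Theorems.Handoff
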